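import Summits.BirchSwinnertonDyer.BirchSwinnertonDyer.Theorems.EisensteinPrimesAcTwistDeformationSUROfTateTC
import HarnessLib

/-!
# v30 «SurC» re-typing of `EisensteinPrimesAcTwistDeformationSUROfTateTC`: Greenberg 2016 Prop. 2.6.3 by name ↦ its case (c) at totally complex `K` by name

Route `EisensteinPrimes` (rung K5), crux 2 `GoodLatticeBDPValue` (stmt-BirchSwinnertonDyer-19032), line `halves`;
cell `bsd-eis`, width seat `bsd-line-x1-p1-w5` gen 9 for LEAD g9 (LEAD ROUTING #3, 2026-08-29), helper (`--supports`).

This file re-types, token for token, the theorems of `EisensteinPrimesAcTwistDeformationSUROfTateTC` that carry Greenberg 2016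
Prop. 2.6.3 = Greenberg 2010 Prop. 3.2.1 BY NAME (`h263 : Greenberg2016.prop263_sur_of_crk`: SUR(𝐃, 𝓛) from
LEO + CRK + (a) ∨ (b) ∨ (c), every number field) with that hypothesis replaced by its CASE (c) AT TOTALLY
COMPLEX FIELDS (`h263 : Greenberg2016.prop263_sur_of_crk_caseC_tc`, the special case p696608 appended to
`Literature/…/Greenberg2016/GlobalToLocalSurjectivity.lean`): every leaf of the line applies Prop. 2.6.3 in case (c)
(`η = 𝔭`, `Q_𝓛(K_𝔭, 𝐃) = 0` divisible) at an imaginary quadratic — hence totally complex — `K`, so the weaker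
hypothesis suffices; the special case is the END STATEMENT of the cell's kernel road «SUR-Λ»
(`prop263_sur_of_crk_caseC_tc_holds`, from the tree's Poitou–Tate at totally complex fields), after which the
LEAD drops the name from the line (v30).  Statements are otherwise VERBATIM (same binder order, new names
`<name>_ofSurC`); proofs are the tree proofs with the last argument of the leaf call, the third-disjunct
injection of the case-(c) witness, replaced by the witness itself (the `IsTotallyComplex K` instance being
supplied from `IsImaginaryQuadratic K`) and the re-typed
callees called; helpers without `h263` are used from the imported `…OfTateTC` file unchanged.

Theorems only; no definition, no named fact, no `sorry`, no instance. HONEST FRAMING: conditional on the PUBLISHED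
named facts carried as hypotheses; closes nothing by itself; no summit statement / BSD / the crux is proved here.

## References
* R. Greenberg, *On the structure of Selmer groups*, Springer PROMS 188 (2016), Prop. 2.6.3 (§2.6 p. 10). [Greenberg2016Selmer]
* R. Greenberg, *Surjectivity of the global-to-local map defining a Selmer group*, Kyoto J. Math. 50 (2010), Prop. 3.2.1 (c) (p. 15). [Greenberg2010]
* (the references of the re-typed file apply verbatim)
-/

set_option autoImplicit false
-- `Summit.<P>.<Sub>` repeats `BirchSwinnertonDyer` by the tree's layout convention (D-0017)
set_option linter.dupNamespace false

noncomputable section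

open scoped Classical
open NumberField IsDedekindDomain Field
open Literature.NumberTheory.EllipticCurves Literature.NumberTheory.GaloisRepresentations
  Literature.NumberTheory.IwasawaTheory Literature.NumberTheory.IwasawaTheory.Greenberg2016
  Literature.NumberTheory.IwasawaTheory.Greenberg2006
  Summit.BirchSwinnertonDyer.BirchSwinnertonDyer.Theorems.TwistDeformationCofree
  Summit.BirchSwinnertonDyer.BirchSwinnertonDyer.Theorems.GreenbergFullAtSelmer

universe u

namespace Summit.BirchSwinnertonDyer.BirchSwinnertonDyer.Theorems.AcTwistDeformation

section QGlobal

variable {Λ : Type u} [CommRing Λ] {ι : Type u} [Fintype ι] [DecidableEq ι]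
  {T : ι → Type u} [∀ i, AddCommGroup (T i)] [∀ i, Module Λ (T i)]

variable {K : Type u} [Field K] [NumberField K] {S : Set (HeightOneSpectrum (𝓞 K))}
  [TopologicalSpace Λ] {D : Type u} [AddCommGroup D] [Module Λ D] [TopologicalSpace D] [DiscreteTopology D]
  [ContinuousSMul Λ D] {ρ : ContinuousRep (GaloisGroupUnramifiedOutside K S) Λ D}

end QGlobal

section SUR

variable {K : Type} [Field K] [NumberField K] {S : Set (HeightOneSpectrum (𝓞 K))} {p : ℕ} [Fact p.Prime]
  {A : Type} [AddCommGroup A] [Module ℤ_[p] A] [TopologicalSpace A] [DiscreteTopology A]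
  [TopologicalSpace (PowerSeries ℤ_[p])] [IsTopologicalRing (PowerSeries ℤ_[p])]
  [IsTopologicalAddGroup (BigRepModule ℤ_[p] p A)]
  [ContinuousSMul (PowerSeries ℤ_[p]) (BigRepModule ℤ_[p] p A)]
  (hS : ∀ v : HeightOneSpectrum (𝓞 K), ((p : ℕ) : 𝓞 K) ∈ v.asIdeal → v ∈ S)
  (κ : ZpExtension K p) (ρ₀ : ContinuousRep (GaloisGroupUnramifiedOutside K S) ℤ_[p] A)

/-- **[v30 `OfSurC` re-typing: Greenberg 2016 Prop. 2.6.3 by name ↦ its case (c) at totally complex `K` by name (`prop263_sur_of_crk_caseC_tc`).]** [cite: Greenberg2010, Prop. 3.2.1 (c) (p. 15)] **[T28b `OfTateTC` re-typing: Greenberg 2006 Prop. 3.2 by name ↦ Milne ADT I Thm. 5.1 by name AT TOTALLY COMPLEX FIELDS (Prop. 3.2 is read in degrees ≤ 2 and at totally complex fields only, `prop32_global_le_two_of_tate_tc`).]** [cite: MilneADT2006, I Thm. 5.1 (p. 67)] **SUR(`𝐃₁`, `𝓛_𝔭`) — Greenberg 2016 Prop. 2.6.3 (c) at the ONE-variable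 twist deformation
`𝐃₁ = bigRep κ ρ₀` of ANY `A ≃ ℚ_p/ℤ_p` on which `G_{K,S}` acts by a character, over a `ℤ_p`-extension `κ`
of an IMAGINARY QUADRATIC `K` with `p = 𝔭𝔭̄` split and no place of `S` splitting completely in `K_∞`:**
the global-to-local map `φ_{𝓛_𝔭} : H¹(K_Σ/K, 𝐃₁) → ∏_{w∈Σ} H¹(K_w, 𝐃₁)/L_w` (`L_𝔭 = ⊤`, `L_w = 0` for
`w ≠ 𝔭`) IS SURJECTIVE, granted five published facts by name (Greenberg 2016 Prop. 2.6.3; Greenberg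
2006 Props. 4.1, 4.2, 3.2, §5 A) and `corank_Λ S_{𝓛_𝔭}(K, 𝐃₁) = 0` with `S_{𝓛_𝔭}` cofinitely generated.
DISCHARGED here: `𝐃₁` divisible / cofree / corank one / cofinitely generated / `p`-primary
(`…AcTwistDeformationCofree`); `h⁰ = 0`, LOC_𝔭⁽¹⁾, the squeeze `h¹ = 1 ∧ h² = 0`, LEO
(`…AcTwistDeformationLEO`); `corank Q = 1`, cofinite generation of `Q`, CRK (§1); condition (c) at `𝔭`.
[cite: Greenberg2016Selmer, Prop. 2.6.3 (c) (§2.6 p. 10 L13–22), §4.3 p. 20 L19–30]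
[cite: Greenberg2010, Prop. 3.2.1 (p. 15), Lemma 5.2.2 (PDF p. 28)]
[cite: Greenberg2006, Prop. 3.2 p. 358, Props. 4.1–4.2 (§4 A pp. 367–368), §5 A (p. 373)] -/
theorem bigRep_fullAt_SUR_ofSurC (h263 : prop263_sur_of_crk_caseC_tc) (h41 : prop41_globalEulerPoincareCorank)
    (h42 : prop42_localEulerPoincareCorank) (h5A : sec5A_localH2_subsingleton_of_LOC1)
    (h32 : (∀ (L : Type) [Field L] [NumberField L] [IsTotallyComplex L], Literature.NumberTheory.GaloisCohomology.tateGlobalEulerPoincareCharacteristic L))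
    (hSf : S.Finite) (hK : IsImaginaryQuadratic K) (e : A ≃ₗ[ℤ_[p]] QpModZp p)
    (hscalar : ∀ g : GaloisGroupUnramifiedOutside K S, ∃ t : ℤ_[p]ˣ, ∀ a : A, ρ₀ g a = (t : ℤ_[p]) • a)
    (hsup : ∀ v : HeightOneSpectrum (𝓞 K), v ∈ S →
      ∃ σ : absoluteGaloisGroup (Place.Completion (Sum.inr v : Place K)),
        κ (absGaloisRestrict K _ σ) ≠ 1)
    {𝔭 𝔭bar : HeightOneSpectrum (𝓞 K)} (hne : 𝔭bar ≠ 𝔭)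
    (hp𝔭 : ((p : ℕ) : 𝓞 K) ∈ 𝔭.asIdeal) (hp𝔭bar : ((p : ℕ) : 𝓞 K) ∈ 𝔭bar.asIdeal)
    (hSel : HasCorank (PowerSeries ℤ_[p])
      (fullAtSpecification S (bigRep (κ.liftUnramifiedOutside S hS) ρ₀) (Sum.inr 𝔭)).selmer 0)
    (hSelfg : IsCofinitelyGenerated (PowerSeries ℤ_[p])
      (fullAtSpecification S (bigRep (κ.liftUnramifiedOutside S hS) ρ₀) (Sum.inr 𝔭)).selmer) :
    (fullAtSpecification S (bigRep (κ.liftUnramifiedOutside S hS) ρ₀) (Sum.inr 𝔭)).SUR := by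
  set ρ := bigRep (κ.liftUnramifiedOutside S hS) ρ₀ with hρ
  -- standing clauses of the arena at `Λ = R = ℤ_p⟦T⟧`
  have hΛ := nonempty_iwasawaAlgebra_ringEquiv_mvPowerSeries p
  have hcpl := isAdicComplete_maximalIdeal_iwasawaAlgebra p
  have hres := finite_residueField_iwasawaAlgebra p
  have hchar := charP_residueField_iwasawaAlgebra p
  have hinjΛ : Function.Injective (algebraMap (PowerSeries ℤ_[p]) (PowerSeries ℤ_[p])) :=
    fun a b h ↦ by simpa using h
  have hfin : Module.Finite (PowerSeries ℤ_[p]) (PowerSeries ℤ_[p]) := inferInstance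
  have hlin : ∀ (g : GaloisGroupUnramifiedOutside K S) (r : PowerSeries ℤ_[p])
      (d : BigRepModule ℤ_[p] p A), ρ g (r • d) = r • ρ g d := fun g r d ↦ map_smul (ρ g) r d
  -- the instance data from ONE `e : A ≃ₗ[ℤ_p] ℚ_p/ℤ_p`
  obtain ⟨hA, jQ, -, hinjQ, hsurjQ⟩ := QpModZp.exists_character_hinj_hsurj_of_linearEquiv e
  obtain ⟨jU, -, hinjU, hsurjU⟩ := QpModZp.exists_unitsCarrier_hinj_hsurj_of_linearEquiv K e
  have hcyc : ∀ (v : Place K) (σ : absoluteGaloisGroup v.Completion), ∃ u : ℤ_[p], ∀ a : A,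
      DiscreteGaloisModule.units K (absGaloisRestrict K v.Completion σ) (jU a) = jU (u • a) :=
    fun v σ ↦ QpModZp.exists_units_apply_eq_smul K jU hsurjU _
  -- `𝐃₁`: divisible, cofree of corank one, cofinitely generated, `p`-primary
  have hdiv := isDivisible_bigRepModule hA jQ hinjQ hsurjQ
  have hT := isCofree_bigRepModule hA jQ hinjQ hsurjQ
  have hcf := isCofinitelyGenerated_bigRepModule hA jQ hinjQ hsurjQ
  have hm := hasCorank_one_bigRepModule hA jQ hinjQ hsurjQ
  have hpD : ∀ d : BigRepModule ℤ_[p] p A, ∃ n : ℕ, (p ^ n : ℤ) • d = 0 := exists_zpow_smul_eq_zero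
  -- `K` imaginary quadratic, `p` split
  haveI := hK.2
  have hKc : ∀ w : InfinitePlace K, w.IsComplex := IsTotallyComplex.isComplex
  have hr₂ := nrComplexPlaces_eq_one_of_isImaginaryQuadratic hK
  have hdeg : 𝔭bar.asIdeal.ramificationIdx ℤ * 𝔭bar.asIdeal.inertiaDeg ℤ = 1 :=
    (ncard_primesOver_eq_two_and_deg_one_of_ne hK.1 hp𝔭 hp𝔭bar hne).2 hp𝔭bar
  have hSp : ∀ v : HeightOneSpectrum (𝓞 K), v ∈ S → ((p : ℕ) : 𝓞 K) ∈ v.asIdeal →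
      v = 𝔭 ∨ v = 𝔭bar := fun v _ hv ↦ eq_or_eq_of_natCast_mem_of_ne hK.1 hp𝔭 hp𝔭bar hne hv
  -- local conditions at the finite places of `Σ` from the `σ`-supply
  have hLOC1fin : ∀ v : HeightOneSpectrum (𝓞 K), v ∈ S → LOC1 S ρ (Sum.inr v) := fun v hv ↦ by
    obtain ⟨σ, hσ⟩ := hsup v hv
    obtain ⟨t, ht⟩ := hscalar (localToUnramified S (Sum.inr v) σ)
    obtain ⟨u, hu⟩ := hcyc (Sum.inr v) σ
    exact bigRep_LOC1 S hS κ ρ₀ hA jU hinjU hsurjU (Sum.inr v) σ t ht hu hσ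
  have h0loc : ∀ v : HeightOneSpectrum (𝓞 K), v ∈ S →
      HasCorank (PowerSeries ℤ_[p]) ((localRep S ρ (Sum.inr v)).H 0) 0 := fun v hv ↦ by
    obtain ⟨σ, hσ⟩ := hsup v hv
    exact hasCorank_localH0_bigRep_zero S hS κ ρ₀ hscalar (Sum.inr v) hσ
  have h2loc : ∀ v : HeightOneSpectrum (𝓞 K), v ∈ S →
      HasCorank (PowerSeries ℤ_[p]) ((localRep S ρ (Sum.inr v)).H 2) 0 := fun v hv ↦
    hasCorank_localH2_zero_of_sec5A ρ h5A hSf hS hΛ hpD hcf (hLOC1fin v hv)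
  have hcfgloc : ∀ v : Place K, InSigma S v → IsCofinitelyGenerated (PowerSeries ℤ_[p])
      ((localRep S ρ v).H 1) := fun v _ ↦ prop32_local_of_holds hSf hS hΛ ρ hpD hcf v 1
  -- global `h⁰ = 0`: a class with `κ ≠ 0` exists (`κ` is onto)
  have h0 : HasCorank (PowerSeries ℤ_[p]) (ρ.H 0) 0 := by
    obtain ⟨g, hg⟩ := κ.liftUnramifiedOutside_surjective S hS (Multiplicative.ofAdd 1)
    refine hasCorank_H0_bigRep_zero S hS κ ρ₀ hscalar (g := g) ?_
    rw [hg]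
    exact fun h ↦ one_ne_zero (Multiplicative.ofAdd.injective (h.trans ofAdd_zero.symm))
  -- `corank Q = 1`, `Q` cofinitely generated
  have hη'1 : HasCorank (PowerSeries ℤ_[p]) ((localRep S ρ (Sum.inr 𝔭bar)).H 1) 1 :=
    hasCorank_localH1_of_prop42_degree_one ρ h42 hSf hS hΛ hpD hcf hp𝔭bar hdeg hm
      (h0loc 𝔭bar (hS 𝔭bar hp𝔭bar)) (h2loc 𝔭bar (hS 𝔭bar hp𝔭bar))
  have hcot : ∀ v : Place K, InSigma S v → v ≠ Sum.inr 𝔭 → v ≠ Sum.inr 𝔭bar →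
      IsCotorsion (PowerSeries ℤ_[p]) ((localRep S ρ v).H 1) := by
    rintro (w | v) hv h1 h2'
    · exact isCotorsion_localH1_inl_of_isComplex S ρ (hKc w)
    · have hvS : v ∈ S := (inSigma_inr_iff S v).mp hv
      have hv𝔭 : v ≠ 𝔭 := fun h ↦ h1 (by rw [h])
      have hv𝔭bar : v ≠ 𝔭bar := fun h ↦ h2' (by rw [h])
      have hvp : ((p : ℕ) : 𝓞 K) ∉ v.asIdeal := fun h ↦ by
        rcases hSp v hvS h with h' | h'
        · exact hv𝔭 h'
        · exact hv𝔭bar h'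
      exact isCotorsion_localH1_of_prop42 ρ h42 hSf hS hΛ hpD hcf hvp hm (h0loc v hvS) (h2loc v hvS)
        (hcfgloc (Sum.inr v) hv)
  have hQ : HasCorank (PowerSeries ℤ_[p]) (fullAtSpecification S ρ (Sum.inr 𝔭)).QGlobal 1 :=
    hasCorank_QGlobal_fullAt_one hSf (hS 𝔭bar hp𝔭bar) hne hη'1 hcot
  have hQfg : IsCofinitelyGenerated (PowerSeries ℤ_[p]) (fullAtSpecification S ρ (Sum.inr 𝔭)).QGlobal :=
    isCofinitelyGenerated_QGlobal_fullAt hSf 𝔭 hcfgloc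
  -- the squeeze: `h¹ = 1`, `h² = 0`; LEO; CRK
  obtain ⟨hH1, hH2⟩ := hasCorank_H1_one_and_H2_zero ρ h41 hSf hS hKc hr₂ hΛ hpD hcf hm h0
    (fullAtSpecification S ρ (Sum.inr 𝔭)) hSel hSelfg hQ hQfg
  have hLEO : LEO S ρ := leo_of_hasCorank_H2_zero_ofTateTC ρ h32 hSf hS hΛ hpD hcf hH2
  have hCRK : (fullAtSpecification S ρ (Sum.inr 𝔭)).CRK :=
    CRK_of_hasCorank _ (s₀ := 0) (q₀ := 1) (by simpa using hH1) hSel hQ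
  -- condition (c) at `η = 𝔭`: LOC⁽¹⁾ and `Q_𝔭 = 0` divisible
  have hQ𝔭 : IsDivisible (PowerSeries ℤ_[p]) ((fullAtSpecification S ρ (Sum.inr 𝔭)).Q (Sum.inr 𝔭)) := by
    haveI : Subsingleton ((fullAtSpecification S ρ (Sum.inr 𝔭)).Q (Sum.inr 𝔭)) :=
      Submodule.Quotient.subsingleton_iff.mpr (fullAtSpecification_self (Sum.inr 𝔭))
    exact fun θ _ s ↦ ⟨s, Subsingleton.elim _ _⟩
  -- Prop. 2.6.3 (c)
  exact h263 p K S hSf hS (PowerSeries ℤ_[p]) 1 hΛ (PowerSeries ℤ_[p]) hinjΛ hfin hcpl hres hchar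
    (BigRepModule ℤ_[p] p A) ρ hlin hT hpD (fullAtSpecification S ρ (Sum.inr 𝔭))
    (fullAtSpecification_isStable (Sum.inr 𝔭) hlin) hdiv hLEO hCRK
    ⟨𝔭, hS 𝔭 hp𝔭, hLOC1fin 𝔭 (hS 𝔭 hp𝔭), hQ𝔭⟩

end SUR

end Summit.BirchSwinnertonDyer.BirchSwinnertonDyer.Theorems.AcTwistDeformation

end
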